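import Literature.MathematicalPhysics.QuantumFieldTheory.Balaban1983to89.BlockAveragingEMLProp2
import Summits.QuantumFields.YangMills.Theorems.UnitScaleTiltAvgCurvGradRect
import Summits.QuantumFields.YangMills.Theorems.UnitScaleTiltProp7HolRatioPerStep
import HarnessLib

/-!
# Non-abelian lattice Stokes as an EXACT ORDERED PRODUCT with explicit transports, and the second-order product letters — the LETTERS file of
# `UnitScaleGibbsBlockPlaquetteStokesLinearisation` (brick (b′) of the S_lin stub of the crux idea «gross-sd-transfer», LINE 28 candidate on
# `UnitScaleTilt.HistoryTailL`, stmt-QuantumFields-19936; `Cruxes/HistoryTailL/Ideas/gross-sd-transfer.md`, `GrossTransferAnnex1.md` §2 (iv); ideator ym-r3-idea-2 g15's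
# word «px10: GO (b′)» 2026-08-29T16:31:51Z)

T. Bałaban, *Averaging operations for lattice gauge theories*, Commun. Math. Phys. **98** (1985) 17–51 [Balaban1985Averaging], (9) p. 18 (plaquette and contour
variables `U(∂p)`, `U(Γ)`), (19) p. 21 (`|U(∂R) − 1| ≤ Σ |U(∂p) − 1|`, the non-abelian Stokes INEQUALITY — tree ✓ `B10Eq47AxialChi.dist1_rect_le`, whose two stacking
identities are `private` there and are re-derived here as theorems, then iterated into EXACT `List` products).  T. Bałaban, *Renormalization group approach to lattice
gauge field theories. I*, Commun. Math. Phys. **109** (1987) 249–301 [Balaban1987RG1], (0.3)–(0.4) pp. 252–253 (the straight `L × L` square of the symmetric averaging).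

WHAT THIS FILE PROVES (kernel; 0 `def`, 0 `sorry`; generic `GaugeGroup G` for the identities; `rect`, `rowProd`, `shiftN` are ✓ `B10Eq47AxialChi`'s):
* §0 `List.range` sums are `Finset.range` sums (the torus-geometry letters `Site.shift_comm`, ✓ `AvgCurvGrad.shiftN_shift_comm` ∕ `shiftN_comm'` and the `SU(N)`
  norm letters ✓ `Prop7HolRatioPerStep.norm_coe_eq_one` ∕ `norm_star_coe_eq_one` ∕ `coe_mul_star_self`, ✓ `FederbushMean.dist1_SU_eq` are CITED BY NAME, not restated);
* §1 ★★ `rect_one_eq_prod`: `U(∂R_{a,1}) = ∏_{s = a−1,…,0} g_s·U(∂p_s)·g_s⁻¹`, ★★ `rect_eq_prod_strips`: `U(∂R_{a,b}) = ∏_{t = 0,…,b−1} h_t·U(∂R^{(t)}_{a,1})·h_t⁻¹`, with the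
  EXPLICIT transports `g_s = rowProd U x μ s` (along the base), `h_t = rowProd U x ν t` (up the side), `p_s` the plaquette at `x + s e_μ`, `R^{(t)}` the strip at
  `x + t e_ν` — exact non-abelian Stokes for a rectangle as an ordered product of transported plaquette variables;
* §2 ★ normed-ring letters: `‖∏ xᵢ − 1‖ ≤ (1+δ)^n − 1`, `‖∏ xᵢ − 1 − Σ(xᵢ − 1)‖ ≤ (1+δ)^n − 1 − nδ` for factors within `δ` of `1`, the two-radii form, and
  `(1+δ)^N − 1 − Nδ ≤ (Nδ)²` for `Nδ ≤ 1`;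
* §3 `SU(N) ⊂ M_N(ℂ)`: list products coerce to matrix products (the conjugation letters `g Q g⁻¹ − 1 = g (Q − 1) g*` = ✓ `Prop7CovariantCoercivity.coe_conj_sub_one`
  and `‖g Z g*‖ ≤ ‖Z‖` = ✓ `Prop7CovIterLambdaBound.norm_conj_su_le` are two-line `have`s in the sequel, from ✓ `Prop7HolRatioPerStep.*` — not restated as theorems).
The ESTIMATE (first order with second-order remainder) is the sequel `UnitScaleGibbsBlockPlaquetteStokesLinearisation`.

HONEST SCOPE.  Lattice kinematics of ONE configuration (no measure); a GO'd brick of the stub S_lin of an UNREGISTERED crux idea; proves no stub, nothing of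
«ShallowFluxSecondMomentL» ∕ (Q) ∕ `MeanDeviationL` ∕ K1 ∕ `HistoryTailL`; rung R3 (YM₃ on T³) is NOT d = 4, NOT infinite volume, NOT a mass gap, NOT Clay; the Yang–Mills mass gap
is NOT proved.  Width seat ym3-torus-px10 g7; `--supports stmt-QuantumFields-19936 --as helper`.
-/

set_option autoImplicit false

open scoped BigOperators

namespace Summit.QuantumFields.YangMills.Theorems.UnitScaleGibbsBlockPlaquetteStokesLetters

open Literature.MathematicalPhysics.QuantumFieldTheory.Balaban1983to89
open Literature.MathematicalPhysics.QuantumFieldTheory.Balaban1983to89.B10Eq47AxialChi (shiftN rowProd rect shiftN_succ rowProd_succ)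
open Summit.QuantumFields.YangMills.Theorems.AvgCurvGrad (shiftN_shift_comm shiftN_comm')

variable {P : Params} {j : ℕ}

/-! ## §0 A bookkeeping letter -/

section Geometry

/-- List sums over `List.range` are `Finset.range` sums. [folklore] -/
theorem sum_map_range_eq_sum_range {β : Type*} [AddCommMonoid β] (f : ℕ → β) :
    ∀ b : ℕ, ((List.range b).map f).sum = ∑ t ∈ Finset.range b, f t
  | 0 => by simp
  | b + 1 => by
    rw [List.range_succ, List.map_append, List.sum_append, Finset.sum_range_succ, sum_map_range_eq_sum_range f b,
      List.map_singleton, List.sum_singleton]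

end Geometry

/-! ## §1 Exact non-abelian Stokes as an ordered product with explicit transports -/

section Exact

variable {G : Type*} [GaugeGroup G]

/-- Stacking one more row: `U(∂R_{a,b+1}) = U(∂R_{a,b}) · [h_b·U(∂R^{(b)}_{a,1})·h_b⁻¹]`, `h_b = rowProd U x ν b` the transport from `x` to `x + b e_ν`.
[cite: Balaban1985Averaging, (9) p.18] -/
theorem rect_succ_right' (U : GaugeField P j G) (x : Site P j) (μ ν : Fin P.d) (a b : ℕ) :
    rect U x μ ν a (b + 1) =
      rect U x μ ν a b * (rowProd U x ν b * rect U (shiftN x ν b) μ ν a 1 * (rowProd U x ν b)⁻¹) := by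
  simp only [rect, rowProd_succ, B10Eq47AxialChi.rowProd_zero, one_mul, shiftN_comm' x μ ν a b, shiftN_succ,
    B10Eq47AxialChi.shiftN_zero]
  group

/-- Stacking one more plaquette onto an `a × 1` strip: `U(∂R_{a+1,1}) = [g_a·U(∂p_a)·g_a⁻¹] · U(∂R_{a,1})`, `g_a = rowProd U x μ a`.
[cite: Balaban1985Averaging, (9) p.18] -/
theorem rect_succ_left' (U : GaugeField P j G) (x : Site P j) {μ ν : Fin P.d} (h : μ < ν) (a : ℕ) :
    rect U x μ ν (a + 1) 1 =
      (rowProd U x μ a * GaugeField.plaqHol U ⟨shiftN x μ a, μ, ν, h⟩ * (rowProd U x μ a)⁻¹) * rect U x μ ν a 1 := by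
  simp only [rect, rowProd_succ, B10Eq47AxialChi.rowProd_zero, one_mul, GaugeField.plaqHol, shiftN_succ,
    B10Eq47AxialChi.shiftN_zero, shiftN_shift_comm x μ ν a]
  group

/-- ★★ **EXACT NON-ABELIAN STOKES, STRIP**: `U(∂R_{a,1}) = ∏_{s = a−1, …, 0} g_s·U(∂p_s)·g_s⁻¹` (ordered, descending `s`), `g_s = rowProd U x μ s`,
`p_s` the plaquette at `x + s e_μ`. [cite: Balaban1985Averaging, (9) p.18 and (19) p.21] -/
theorem rect_one_eq_prod (U : GaugeField P j G) (x : Site P j) {μ ν : Fin P.d} (h : μ < ν) :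
    ∀ a : ℕ, rect U x μ ν a 1 =
      (((List.range a).reverse).map fun s =>
        rowProd U x μ s * GaugeField.plaqHol U ⟨shiftN x μ s, μ, ν, h⟩ * (rowProd U x μ s)⁻¹).prod
  | 0 => by simp [rect, rowProd]
  | a + 1 => by
    rw [rect_succ_left' U x h a, rect_one_eq_prod U x h a, List.range_succ, List.reverse_append, List.reverse_singleton,
      List.singleton_append, List.map_cons, List.prod_cons]

/-- ★★ **EXACT NON-ABELIAN STOKES, RECTANGLE**: `U(∂R_{a,b}) = ∏_{t = 0, …, b−1} h_t·U(∂R^{(t)}_{a,1})·h_t⁻¹` (ordered, ascending `t`), `h_t = rowProd U x ν t`,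
`R^{(t)}` the `a × 1` strip with corner `x + t e_ν`. [cite: Balaban1985Averaging, (9) p.18 and (19) p.21] -/
theorem rect_eq_prod_strips (U : GaugeField P j G) (x : Site P j) (μ ν : Fin P.d) (a : ℕ) :
    ∀ b : ℕ, rect U x μ ν a b =
      ((List.range b).map fun t => rowProd U x ν t * rect U (shiftN x ν t) μ ν a 1 * (rowProd U x ν t)⁻¹).prod
  | 0 => by simp [rect, rowProd]
  | b + 1 => by
    rw [rect_succ_right' U x μ ν a b, rect_eq_prod_strips U x μ ν a b, List.range_succ, List.map_append,
      List.prod_append, List.map_singleton, List.prod_singleton]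

end Exact

/-! ## §2 Products of near-`1` elements to first and second order (normed ring letters) -/

section Algebra

variable {𝔸 : Type*} [NormedRing 𝔸]

/-- `‖∏ xᵢ − 1‖ ≤ (1+δ)^n − 1` for a list of `n` elements within `δ` of `1`. [folklore] -/
theorem norm_list_prod_sub_one_le {δ : ℝ} (hδ : 0 ≤ δ) :
    ∀ l : List 𝔸, (∀ x ∈ l, ‖x - 1‖ ≤ δ) → ‖l.prod - 1‖ ≤ (1 + δ) ^ l.length - 1
  | [], _ => by simp
  | x :: l, h => by
    have hx : ‖x - 1‖ ≤ δ := h x (by simp)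
    have ih := norm_list_prod_sub_one_le hδ l fun y hy => h y (by simp [hy])
    have hP : 0 ≤ (1 + δ) ^ l.length - 1 := by
      have : (1 : ℝ) ≤ (1 + δ) ^ l.length := one_le_pow₀ (by linarith)
      linarith
    rw [List.prod_cons, List.length_cons]
    have e : x * l.prod - 1 = (x - 1) * (l.prod - 1) + (x - 1) + (l.prod - 1) := by noncomm_ring
    rw [e]
    calc ‖(x - 1) * (l.prod - 1) + (x - 1) + (l.prod - 1)‖
        ≤ ‖x - 1‖ * ‖l.prod - 1‖ + ‖x - 1‖ + ‖l.prod - 1‖ :=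
          (norm_add_le _ _).trans (add_le_add ((norm_add_le _ _).trans (add_le_add (norm_mul_le _ _) le_rfl)) le_rfl)
      _ ≤ δ * ((1 + δ) ^ l.length - 1) + δ + ((1 + δ) ^ l.length - 1) := by gcongr
      _ = (1 + δ) ^ (l.length + 1) - 1 := by ring

/-- ★ **Products of near-`1` elements to SECOND order**: `‖∏ xᵢ − 1 − Σ (xᵢ − 1)‖ ≤ (1+δ)^n − 1 − n·δ` for a list of `n` elements within `δ` of `1`.
[folklore] -/
theorem norm_list_prod_sub_one_sub_sum_le {δ : ℝ} (hδ : 0 ≤ δ) :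
    ∀ l : List 𝔸, (∀ x ∈ l, ‖x - 1‖ ≤ δ) →
      ‖l.prod - 1 - (l.map fun x => x - 1).sum‖ ≤ (1 + δ) ^ l.length - 1 - l.length * δ
  | [], _ => by simp
  | x :: l, h => by
    have hx : ‖x - 1‖ ≤ δ := h x (by simp)
    have h' : ∀ y ∈ l, ‖y - 1‖ ≤ δ := fun y hy => h y (by simp [hy])
    have ih := norm_list_prod_sub_one_sub_sum_le hδ l h'
    have ih0 := norm_list_prod_sub_one_le hδ l h'
    have hP : 0 ≤ (1 + δ) ^ l.length - 1 := by
      have : (1 : ℝ) ≤ (1 + δ) ^ l.length := one_le_pow₀ (by linarith)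
      linarith
    rw [List.prod_cons, List.length_cons, List.map_cons, List.sum_cons]
    have e : x * l.prod - 1 - ((x - 1) + (l.map fun x => x - 1).sum) =
        (x - 1) * (l.prod - 1) + (l.prod - 1 - (l.map fun x => x - 1).sum) := by noncomm_ring
    rw [e]
    calc ‖(x - 1) * (l.prod - 1) + (l.prod - 1 - (l.map fun x => x - 1).sum)‖
        ≤ ‖x - 1‖ * ‖l.prod - 1‖ + ‖l.prod - 1 - (l.map fun x => x - 1).sum‖ :=
          (norm_add_le _ _).trans (add_le_add (norm_mul_le _ _) le_rfl)
      _ ≤ δ * ((1 + δ) ^ l.length - 1) + ((1 + δ) ^ l.length - 1 - l.length * δ) := by gcongr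
      _ = (1 + δ) ^ (l.length + 1) - 1 - (↑(l.length + 1) : ℝ) * δ := by push_cast; ring

/-- The second-order remainder with TWO radii: if `‖X i − 1‖ ≤ ε` and `‖X i − 1 − Y i‖ ≤ ρ` for every factor, then
`‖∏ X i − 1 − Σ Y i‖ ≤ (1+ε)^n − 1 − n·ε + n·ρ` (the outer Stokes layer: strips within `ε` of `1`, each linearised up to `ρ`). [folklore] -/
theorem norm_list_prod_sub_one_sub_sum_le₂ {ι : Type*} {ε ρ : ℝ} (hε : 0 ≤ ε) (X Y : ι → 𝔸)
    (hX : ∀ i, ‖X i - 1‖ ≤ ε) (hY : ∀ i, ‖X i - 1 - Y i‖ ≤ ρ) :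
    ∀ l : List ι, ‖(l.map X).prod - 1 - (l.map Y).sum‖ ≤ (1 + ε) ^ l.length - 1 - l.length * ε + l.length * ρ
  | [] => by simp
  | i :: l => by
    have ih := norm_list_prod_sub_one_sub_sum_le₂ hε X Y hX hY l
    have ih0 := norm_list_prod_sub_one_le hε (l.map X) (by
      intro x hx
      obtain ⟨k, -, rfl⟩ := List.mem_map.1 hx
      exact hX k)
    rw [List.length_map] at ih0
    have hP : 0 ≤ (1 + ε) ^ l.length - 1 := by
      have : (1 : ℝ) ≤ (1 + ε) ^ l.length := one_le_pow₀ (by linarith)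
      linarith
    rw [List.map_cons, List.prod_cons, List.map_cons, List.sum_cons, List.length_cons]
    have e : X i * (l.map X).prod - 1 - (Y i + (l.map Y).sum) =
        (X i - 1) * ((l.map X).prod - 1) + (X i - 1 - Y i) + ((l.map X).prod - 1 - (l.map Y).sum) := by noncomm_ring
    rw [e]
    calc ‖(X i - 1) * ((l.map X).prod - 1) + (X i - 1 - Y i) + ((l.map X).prod - 1 - (l.map Y).sum)‖
        ≤ ‖X i - 1‖ * ‖(l.map X).prod - 1‖ + ‖X i - 1 - Y i‖ + ‖(l.map X).prod - 1 - (l.map Y).sum‖ :=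
          (norm_add_le _ _).trans (add_le_add ((norm_add_le _ _).trans (add_le_add (norm_mul_le _ _) le_rfl)) le_rfl)
      _ ≤ ε * ((1 + ε) ^ l.length - 1) + ρ + ((1 + ε) ^ l.length - 1 - l.length * ε + l.length * ρ) := by
          gcongr
          · exact hX i
          · exact hY i
      _ = (1 + ε) ^ (l.length + 1) - 1 - (↑(l.length + 1) : ℝ) * ε + (↑(l.length + 1) : ℝ) * ρ := by push_cast; ring

/-- The friendly size of the second-order remainder: `(1+δ)^N − 1 − N·δ ≤ (N·δ)²` once `N·δ ≤ 1` (via `(1+δ)^N ≤ e^{Nδ}` and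
Mathlib's `|e^u − 1 − u| ≤ u²` for `|u| ≤ 1`). [folklore] -/
theorem one_add_pow_sub_one_sub_mul_le_sq {δ : ℝ} (hδ : 0 ≤ δ) (N : ℕ) (hN : (N : ℝ) * δ ≤ 1) :
    (1 + δ) ^ N - 1 - N * δ ≤ ((N : ℝ) * δ) ^ 2 := by
  have h1 : (1 + δ) ^ N ≤ Real.exp ((N : ℝ) * δ) := by
    rw [Real.exp_nat_mul]
    exact pow_le_pow_left₀ (by linarith) (by linarith [Real.add_one_le_exp δ]) N
  have hu : |(N : ℝ) * δ| ≤ 1 := by rw [abs_of_nonneg (by positivity)]; exact hN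
  have h2 := Real.abs_exp_sub_one_sub_id_le hu
  have h3 : Real.exp ((N : ℝ) * δ) - 1 - (N : ℝ) * δ ≤ ((N : ℝ) * δ) ^ 2 := (le_abs_self _).trans h2
  linarith

end Algebra

/-! ## §3 `SU(N)` letters: unitary coercions and the operator norm -/

section SU

open scoped Matrix.Norms.L2Operator

variable {n : Type*} [Fintype n] [DecidableEq n]

/-- A list product in `SU(N)` coerces to the matrix product of the coercions. [folklore] -/
theorem coe_list_prod (l : List (Matrix.specialUnitaryGroup n ℂ)) :
    ((l.prod : Matrix.specialUnitaryGroup n ℂ) : Matrix n n ℂ) =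
      (l.map fun g : Matrix.specialUnitaryGroup n ℂ => (g : Matrix n n ℂ)).prod :=
  Submonoid.coe_list_prod _ l

end SU

end Summit.QuantumFields.YangMills.Theorems.UnitScaleGibbsBlockPlaquetteStokesLetters
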